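import Literature.AlgebraicGeometry.AbelianSchemes.AbelianSchemeFibreHom
import Literature.AlgebraicGeometry.HodgeTheory.AbelianVarietyIsogenyDegreeHomology
import Mathlib.GroupTheory.Coset.Card
import Mathlib.GroupTheory.OrderOfElement
import Mathlib.Data.Set.Card
import HarnessLib

/-!
# The type `δ` of a polarisation descends through an isogeny of coprime degree — finite-group core and the `HasType` transport

Topic `AlgebraicGeometry/AbelianSchemes`; namespace `Literature.AlgebraicGeometry.AbelianSchemes` (generic finite-group core in
the sub-namespace `IsogenyKernelCount`, the wrapper in `AbelianSchemeOver.Polarization`).  THEOREMS ONLY (no definition, no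
named fact, no instance, no notation, no `sorry`; net Literature debt 0).  Cell hodgecm-mathlib (D-0151), E-road / HECKE-LINK
line for `stub_noThinPiece`, socket (B) brick **H2c «`HasType δ` of the polarisation descended through the Hecke kernel, at EVERY
algebraically closed `Ω`»** (B-plan1 (g14) 21:10:34Z; B-p20 (g9) LACK-3): the field-agnostic transport of ★
`AbelianSchemeOver.Polarization.HasType` (kernel on `Ω`-points `≅ (∏ ℤ/δᵢ)²`, [MumfordFogartyKirwan1994] App. 7A) from the
source `λ′ : A′ → Â′` to the descended `λ_B : B → B̂` of an isogeny quotient `ψ : A′ → B` whose degree is prime to `∏ δᵢ`.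

## The mathematics (pure finite-group theory on `Ω`-points; [MumfordAV1970] §7 Thm. 4, §23 Thm. 2; [MilneAV2008] I Prop. 7.1 / §8)

Let `ψ : A′ → B` be onto with kernel `K₀`, `λ′ : A′ → Â′`, `λ_B : B → B̂` onto, `ψ^∨ : B̂ → Â′` with
`ψ^∨ ∘ λ_B ∘ ψ = λ′^ν` (the defining identity of the descended polarisation, «`ψ^*λ_B = ν λ′`»), `A′` `ν`-divisible with
`|A′[ν]| = |K₀| · |ker ψ^∨|` (degree bookkeeping: `deg ψ · deg ψ^∨ = ν^{2g}`), and `|K₀|`, `|ker ψ^∨|` prime to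
`|G|`, `G = (∏ ℤ/δᵢ)²`.  If `φ′ : G ↪ A′` has image `ker λ′`, then `ψ ∘ φ′ : G ↪ B` has image `ker λ_B`
(`IsogenyKernelCount.injective_and_range_comp_eq_ker`):
* INJECTIVE — `ker ψ ∩ ker λ′ = 1` by coprime orders (Lagrange);
* IMAGE `⊆ ker λ_B` — for `a ∈ ker λ′`, `λ_B(ψa) ∈ ker ψ^∨` has order dividing `|G|`, hence is trivial;
* IMAGE `= ker λ_B` — counting with `|ker (g ∘ f)| = |ker f| · |ker g|` for `f` onto (★ `IsogenyDegree.natCard_ker_comp_of_surjective`) applied to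
  `ψ^∨ ∘ λ_B ∘ ψ = λ′ ∘ (·)^ν` both ways: `|A′[ν]| · |G| = |K₀| · |ker λ_B| · |ker ψ^∨|`, so `|ker λ_B| = |G|` and the injection
  is onto.

The wrapper `AbelianSchemeOver.Polarization.hasType_of_fibreIsogenyData` reads this at every geometric point `s : Spec Ω → S` through
★ `fibreHom` / ★ `setOf_algPointsMap_fibreHom_eq_one_eq_kerPointsAt` (`{P | λ_s P = 1} = kerPointsAt s`): given `pol′.HasType δ`
on `A′` and, at every `s`, the four points-level homomorphisms with the data above (supplied by the cell's H1/H2 files: the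
quotient `B = A′/K₀`, the dual isogeny, `ψ^∨ ≫ λ_B ≫ ψ = λ′^ν`, `ν`-divisibility and the two counts), `pol_B.HasType δ`.
Consumers: B-p20 (g9)'s `Polarization.quotientBy` (H2 file (ii)), B-p14 (g14)'s H4 assembler.  HC_CM is proved only modulo the 7
printed citations until rung 0 closes; this file discharges none of them.

## References
* [MumfordAV1970] D. Mumford, *Abelian Varieties* (1970), §7 Thm. 4 (p. 72) (quotients by finite subgroups), §23 Thm. 2 (p. 231)
  (descent of polarisations), §15 Thm. 1 (dual of an isogeny).
* [MilneAV2008] J. S. Milne, *Abelian Varieties* (2008), I Prop. 7.1 and §8 (isogenies, degrees, the dual isogeny).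
* [MumfordFogartyKirwan1994] D. Mumford, J. Fogarty, F. Kirwan, *Geometric Invariant Theory*, 3rd ed. (1994), Ch. 6 §2 Def. 6.3
  (p. 120), App. 7A (pp. 234–235) (the type `δ`), Ch. 7 §3 Lemma 7.11 (p. 140).
-/

set_option autoImplicit false

noncomputable section

universe u

open CategoryTheory AlgebraicGeometry

namespace Literature.AlgebraicGeometry.AbelianSchemes

/-! ### §1 Finite-group core -/

namespace IsogenyKernelCount

/-- An element of a group lying in two FINITE-ORDER situations with coprime cardinalities is trivial: if `x ∈ H` (`Nat.card H`
coprime to `n`) and `orderOf x ∣ n`, then `x = 1`. [folklore] -/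
private theorem eq_one_of_mem_of_orderOf_dvd_coprime {B : Type*} [Group B] (H : Subgroup B) {n : ℕ}
    (hcop : Nat.Coprime (Nat.card H) n) {x : B} (hx : x ∈ H) (hn : orderOf x ∣ n) : x = 1 := by
  have h1 : orderOf x ∣ Nat.card H := H.orderOf_dvd_natCard hx
  exact orderOf_eq_one_iff.1 (Nat.eq_one_of_dvd_coprimes hcop h1 hn)

/-- **TRANSPORT OF THE KERNEL STRUCTURE OF A POLARISATION THROUGH AN ISOGENY OF COPRIME DEGREE** (finite-group core of H2c).
Data: `ψ : A′ → B` onto, `λ′ : A′ → Â′`, `λ_B : B → B̂` onto, `ψ^∨ : B̂ → Â′` with `ψ^∨(λ_B(ψ a)) = λ′(a)^ν`, `a ↦ a^ν` onto on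
`A′`, finite kernels `ker ψ`, `ker ψ^∨` with `|A′[ν]| = |ker ψ| · |ker ψ^∨|`, both cardinalities prime to `|G|`, and an embedding
`φ′ : G ↪ A′` with image `ker λ′`.  Then `ψ ∘ φ′ : G → B` is injective with image EXACTLY `ker λ_B`.
[cite: MumfordAV1970, §23 Thm. 2 (p. 231) and §7 Thm. 4 (p. 72)] [cite: MilneAV2008, I Prop. 7.1 and §8]
[cite: MumfordFogartyKirwan1994, App. 7A (pp. 234–235)] -/
theorem injective_and_range_comp_eq_ker {A' B Ah Bh G : Type*} [CommGroup A'] [CommGroup B] [CommGroup Ah] [CommGroup Bh]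
    [Group G] [Finite G] (ψ : A' →* B) (lam' : A' →* Ah) (lamB : B →* Bh) (ψd : Bh →* Ah) (ν : ℕ)
    (hcomp : ∀ a, ψd (lamB (ψ a)) = lam' a ^ ν) (hψ : Function.Surjective ψ) (hlamB : Function.Surjective lamB)
    (hdiv : Function.Surjective fun a : A' => a ^ ν) (hψfin : Finite ψ.ker) (hψdfin : Finite ψd.ker)
    (hcount : Nat.card (powMonoidHom ν : A' →* A').ker = Nat.card ψ.ker * Nat.card ψd.ker)
    (hcopψ : Nat.Coprime (Nat.card ψ.ker) (Nat.card G)) (hcopd : Nat.Coprime (Nat.card ψd.ker) (Nat.card G))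
    (φ' : G →* A') (hφ' : Function.Injective φ') (hrange' : Set.range φ' = {a | lam' a = 1}) :
    Function.Injective (ψ.comp φ') ∧ Set.range (ψ.comp φ') = {b | lamB b = 1} := by
  classical
  -- orders of elements of `G` divide `|G|`; so do the orders of their images
  have hordG : ∀ x : G, orderOf x ∣ Nat.card G := fun x => orderOf_dvd_natCard x
  have hφ'ker : ∀ x : G, lam' (φ' x) = 1 := fun x => by
    have hx : φ' x ∈ Set.range φ' := ⟨x, rfl⟩
    rw [hrange'] at hx
    exact hx
  -- (a) injectivity: `ker ψ ∩ im φ′ = 1`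
  have hinj : Function.Injective (ψ.comp φ') := by
    refine (injective_iff_map_eq_one _).2 fun x hx => ?_
    rw [MonoidHom.comp_apply] at hx
    have h1 : φ' x = 1 :=
      eq_one_of_mem_of_orderOf_dvd_coprime ψ.ker hcopψ ((MonoidHom.mem_ker).2 hx)
        ((orderOf_map_dvd φ' x).trans (hordG x))
    exact hφ' (by rw [h1, map_one])
  refine ⟨hinj, ?_⟩
  -- (b) image ⊆ kernel
  have hsub : Set.range (ψ.comp φ') ⊆ {b | lamB b = 1} := by
    rintro _ ⟨x, rfl⟩
    rw [Set.mem_setOf_eq, MonoidHom.comp_apply]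
    have hz : lamB (ψ (φ' x)) ∈ ψd.ker := by
      rw [MonoidHom.mem_ker, hcomp, hφ'ker, one_pow]
    refine eq_one_of_mem_of_orderOf_dvd_coprime ψd.ker hcopd hz ?_
    exact ((orderOf_map_dvd lamB _).trans (orderOf_map_dvd ψ _)).trans ((orderOf_map_dvd φ' x).trans (hordG x))
  -- (c) the count `|ker λ_B| = |G|`
  -- `F := ψ^∨ ∘ λ_B ∘ ψ = λ′ ∘ (·)^ν`
  have hF : (ψd.comp lamB).comp ψ = lam'.comp (powMonoidHom ν) := by
    ext a
    simp [hcomp]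
  have hG : Nat.card lam'.ker = Nat.card G := by
    have e : G ≃ Set.range φ' := Equiv.ofInjective φ' hφ'
    rw [Nat.card_congr e]
    refine Nat.card_congr (Equiv.setCongr ?_)
    rw [hrange']
    ext a
    simp [MonoidHom.mem_ker]
  have c1 : Nat.card ((ψd.comp lamB).comp ψ).ker = Nat.card ψ.ker * (Nat.card lamB.ker * Nat.card ψd.ker) := by
    rw [Literature.AlgebraicGeometry.HodgeTheory.IsogenyDegree.natCard_ker_comp_of_surjective ψ (ψd.comp lamB) hψ,
      Literature.AlgebraicGeometry.HodgeTheory.IsogenyDegree.natCard_ker_comp_of_surjective lamB ψd hlamB]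
  have c2 : Nat.card (lam'.comp (powMonoidHom ν)).ker = Nat.card ψ.ker * Nat.card ψd.ker * Nat.card G := by
    rw [Literature.AlgebraicGeometry.HodgeTheory.IsogenyDegree.natCard_ker_comp_of_surjective (powMonoidHom ν) lam'
      (fun a => hdiv a), hcount, hG]
  have hψpos : 0 < Nat.card ψ.ker := Nat.card_pos
  have hψdpos : 0 < Nat.card ψd.ker := Nat.card_pos
  have hcardK : Nat.card lamB.ker = Nat.card G := by
    have h := c1.symm.trans (by rw [hF, c2])
    -- `|ker ψ| · (|ker λ_B| · |ker ψ^∨|) = |ker ψ| · |ker ψ^∨| · |G|`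
    have h' : Nat.card ψ.ker * (Nat.card lamB.ker * Nat.card ψd.ker) =
        Nat.card ψ.ker * (Nat.card G * Nat.card ψd.ker) := by rw [h]; ring
    have h'' := Nat.eq_of_mul_eq_mul_left hψpos h'
    exact Nat.eq_of_mul_eq_mul_right hψdpos h''
  -- (d) an injection between finite sets of equal size is onto
  have hfinK : ({b | lamB b = 1} : Set B).Finite := by
    have hne : Nat.card lamB.ker ≠ 0 := by
      rw [hcardK]; exact Nat.card_pos.ne'
    have : Finite lamB.ker := Nat.finite_of_card_ne_zero hne
    exact Set.toFinite (lamB.ker : Set B)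
  refine Set.eq_of_subset_of_ncard_le hsub ?_ hfinK
  rw [Set.ncard_range_of_injective hinj, ← hcardK]
  exact le_of_eq (Nat.card_coe_set_eq (lamB.ker : Set B)).symm

end IsogenyKernelCount

/-! ### §2 The `HasType δ` transport at every geometric point -/

namespace AbelianSchemeOver

open Literature.AlgebraicGeometry.Motives
open scoped MonObj

variable {S : Scheme.{u}} {A' B : AbelianSchemeOver S}

/-- `|(∏ ℤ/δᵢ)²| = (∏ δᵢ) * (∏ δᵢ)`. [cite: MumfordFogartyKirwan1994, App. 7A (pp. 234–235)] -/
theorem natCard_multiplicative_levelKernel {g : ℕ} {δ : Fin g → ℕ} :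
    Nat.card (Multiplicative (((i : Fin g) → ZMod (δ i)) × ((i : Fin g) → ZMod (δ i)))) = (∏ i, δ i) * ∏ i, δ i := by
  rw [Nat.card_eq_of_bijective Multiplicative.toAdd Multiplicative.toAdd.bijective, Nat.card_prod, Nat.card_pi]
  simp [Nat.card_zmod]

/-- **H2c — THE TYPE `δ` DESCENDS THROUGH AN ISOGENY OF DEGREE PRIME TO `∏ δᵢ`, AT EVERY GEOMETRIC POINT.**  Let `pol′` be a
polarisation OF TYPE `δ` of `A′/S` and `polB` a polarisation of `B/S`, and suppose that at every algebraically closed point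
`s : Spec Ω → S` there are homomorphisms of `Ω`-points `ψ_s : A′_s(Ω) → B_s(Ω)` (the isogeny) and `ψ^∨_s : B̂_s(Ω) → Â′_s(Ω)`
(its dual) with: `ψ^∨_s ∘ λ_{B,s} ∘ ψ_s = λ′_s ^ ν` (the descended-polarisation identity read on points through ★ `fibreHom`),
`ψ_s` and `λ_{B,s}` onto, `a ↦ a^ν` onto on `A′_s(Ω)`, finite kernels with `|A′_s[ν]| = |ker ψ_s| · |ker ψ^∨_s|` and both
prime to `∏ δᵢ`.  Then `polB` is of type `δ`: at each `s` the embedding `(∏ ℤ/δᵢ)² ↪ A′_s(Ω)` onto `K(λ̄′)` composed with `ψ_s`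
is an embedding onto `K(λ̄_B)` (§1 + ★ `setOf_algPointsMap_fibreHom_eq_one_eq_kerPointsAt`).
[cite: MumfordAV1970, §23 Thm. 2 (p. 231) and §7 Thm. 4 (p. 72)] [cite: MumfordFogartyKirwan1994, App. 7A (pp. 234–235) and Ch. 6 §2 Def. 6.3 (p. 120)]
[cite: MilneAV2008, I Prop. 7.1 and §8] -/
theorem Polarization.hasType_of_fibreIsogenyData {D' : A'.DualPair} {DB : B.DualPair} (pol' : A'.Polarization D')
    (polB : B.Polarization DB) [IsMonHom pol'.lam] [IsMonHom polB.lam] {g : ℕ} {δ : Fin g → ℕ} (hT' : pol'.HasType δ)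
    (h : ∀ (Ω : Type u) [Field Ω] [IsAlgClosed Ω] (s : Spec (.of Ω) ⟶ S),
      ∃ (ψ : (A'.fibre s).toAbelianVariety.Points Ω →* (B.fibre s).toAbelianVariety.Points Ω)
        (ψd : (DB.hat.fibre s).toAbelianVariety.Points Ω →* (D'.hat.fibre s).toAbelianVariety.Points Ω) (ν : ℕ),
        (∀ a, ψd (IsMonHom.monoidHom (fibreHom polB.lam s).hom.hom.hom (specOver Ω Ω) (ψ a)) =
            IsMonHom.monoidHom (fibreHom pol'.lam s).hom.hom.hom (specOver Ω Ω) a ^ ν) ∧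
        Function.Surjective ψ ∧
        Function.Surjective (IsMonHom.monoidHom (fibreHom polB.lam s).hom.hom.hom (specOver Ω Ω)) ∧
        Function.Surjective (fun a : (A'.fibre s).toAbelianVariety.Points Ω => a ^ ν) ∧
        Finite ψ.ker ∧ Finite ψd.ker ∧
        Nat.card (powMonoidHom ν : (A'.fibre s).toAbelianVariety.Points Ω →* _).ker = Nat.card ψ.ker * Nat.card ψd.ker ∧
        Nat.Coprime (Nat.card ψ.ker) (∏ i, δ i) ∧ Nat.Coprime (Nat.card ψd.ker) (∏ i, δ i)) :
    polB.HasType δ := by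
  classical
  refine ⟨hT'.1, fun Ω _ _ s => ?_⟩
  haveI : ∀ i, NeZero (δ i) := fun i => ⟨(hT'.1.1 i).ne'⟩
  obtain ⟨ψ, ψd, ν, hcomp, hψ, hlamB, hdiv, hψfin, hψdfin, hcount, hcopψ, hcopd⟩ := h Ω s
  obtain ⟨φ', hφ'inj, hφ'range⟩ := hT'.2 Ω s
  -- cardinality of the level kernel group and the coprimality in the shape of §1
  have hcardG : Nat.card (Multiplicative (((i : Fin g) → ZMod (δ i)) × ((i : Fin g) → ZMod (δ i)))) =
      (∏ i, δ i) * ∏ i, δ i := natCard_multiplicative_levelKernel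
  have hcopψ' : Nat.Coprime (Nat.card ψ.ker)
      (Nat.card (Multiplicative (((i : Fin g) → ZMod (δ i)) × ((i : Fin g) → ZMod (δ i))))) := by
    rw [hcardG]; exact Nat.Coprime.mul_right hcopψ hcopψ
  have hcopd' : Nat.Coprime (Nat.card ψd.ker)
      (Nat.card (Multiplicative (((i : Fin g) → ZMod (δ i)) × ((i : Fin g) → ZMod (δ i))))) := by
    rw [hcardG]; exact Nat.Coprime.mul_right hcopd hcopd
  -- the source range in kernel form
  have hrange' : Set.range φ' =
      {a | IsMonHom.monoidHom (fibreHom pol'.lam s).hom.hom.hom (specOver Ω Ω) a = 1} := by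
    rw [hφ'range, ← setOf_algPointsMap_fibreHom_eq_one_eq_kerPointsAt pol' s]
    rfl
  obtain ⟨hinj, hrange⟩ := IsogenyKernelCount.injective_and_range_comp_eq_ker ψ
    (IsMonHom.monoidHom (fibreHom pol'.lam s).hom.hom.hom (specOver Ω Ω))
    (IsMonHom.monoidHom (fibreHom polB.lam s).hom.hom.hom (specOver Ω Ω)) ψd ν hcomp hψ hlamB hdiv hψfin hψdfin
    hcount hcopψ' hcopd' φ' hφ'inj hrange'
  refine ⟨ψ.comp φ', hinj, ?_⟩
  rw [hrange, ← setOf_algPointsMap_fibreHom_eq_one_eq_kerPointsAt polB s]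
  rfl

end AbelianSchemeOver

end Literature.AlgebraicGeometry.AbelianSchemes

end
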